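import Literature.NumberTheory.ModularForms.DombEtaQuotientDerivatives
import Literature.NumberTheory.ModularForms.LevelSixEisensteinQExpansions
import Summits.BirchSwinnertonDyer.BirchSwinnertonDyer.Theorems.ManinLocalTwoThreeQRemainderCalculus
import HarnessLib

/-!
# The logarithmic derivative of an `η`-quotient is a weight-2 Eisenstein form: `x′ = (πi/12)·(Σ_δ r_δ δ E₂(δτ))·x`, and
# `Σ_δ c_δ δ E₂(δτ) ∈ M₂(Γ₀(N))` whenever `Σ_δ c_δ = 0` — any level `N`

Cell bsd-f2-manin, route `ManinLocalTwoThree` (cruxes C2 `ManinOddAtFour` stmt-22967 / C3 `ManinPrimeToThreeAtNine` stmt-22968),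
prover seat p3 gen 24.  The "E₂ road" to the `η`-identities of a modular parametrisation `X₀(N) → E` whose Weierstrass coordinate
`x − x(O′)` is an `η`-quotient `𝓔 = ∏ η(δτ)^{r_δ}` (weight `0`, so `Σ r_δ = 0`):

* §1 for ANY coefficient vector `c` on the divisors of `N` with `Σ_δ c_δ = 0`, the function `G_c(τ) = Σ_δ c_δ·δ·E₂(δτ)`
  transforms like a weight-`2` form under `Γ₀(N)` (the quasimodular anomalies `−(6ic/π)(cτ+d)` of the `δE₂(δ·)`, tree
  `E2natMul_smul`, are INDEPENDENT of `δ` and add up to `(Σ c_δ)·(…) = 0`), is holomorphic, and is bounded at every cusp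
  (tree `isBoundedAtImInfty_E2natMul_slash`, Hermite decomposition): **`G_c ∈ M₂(Γ₀(N))`** (`exists_modularForm_e2Comb`);
* §2 **`𝓔′ = (πi/12)·G_r·𝓔` on `ℍ`** for `𝓔 = etaQuotient N r` (tree `deriv_etaQuotientC` = Mathlib's `logDeriv_eta_eq_E2`
  factor by factor, moved from `etaQuotientC` on `ℂ` to `etaQuotient ∘ ofComplex` on `ℍ`): `deriv_etaQuotient_eq_e2Comb`;
* §3 the `q`-remainder of each `E₂(δτ) = 1 − 24Σσ₁(n)q^{δn}` to any order (`tendsto_E2_sixMulPt`, tree `hasSum_E2_natMul`).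

Consequence used at level `72` (sequel files): the identity (I2a) `x′ = −2πiφ·2y` becomes `G_r·𝓔 = −48φ·y`, and when
`φ·y/𝓔` is a combination of HOLOMORPHIC `η`-quotients (true at `72`: `φ₇₂ = ⅔h₁ + ⅓h₂`) it is a LINEAR relation in
`M₂(Γ₀(36))`, settled by Sturm's bound on `13` coefficients — no expansion at any cusp other than `∞`.

HONEST FRAMING: a level-free analytic toolkit; nothing here proves C2, C3, Manin's conjecture or BSD; items 22967/22968 stay OPEN.
No definition, no named fact, no sorry. [cite: Zagier2008, §2.3] [cite: DiamondShurman2005, §1.2]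
-/

set_option autoImplicit false
-- lint-debt: the directory name repeats the summit name (sibling precedent `ManinLocalTwoThreeQRemainderCalculus.lean`)
set_option linter.dupNamespace false

noncomputable section

open Complex Filter Topology Set Function Asymptotics Polynomial EisensteinSeries
open UpperHalfPlane hiding I
open scoped Real Topology Manifold MatrixGroups ModularForm
open ModularForm CongruenceSubgroup
open Literature.NumberTheory.ModularForms
open Literature.NumberTheory.EllipticCurves Literature.NumberTheory.EllipticCurves.ModularForms

namespace Summit.BirchSwinnertonDyer.BirchSwinnertonDyer.Theorems.ManinLocalTwoThree.EtaLogDerivativeForms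

open QRemainder

/-! ## §1 `G_c = Σ_δ c_δ δ E₂(δτ) ∈ M₂(Γ₀(N))` when `Σ c_δ = 0` -/

/-- `Γ₀(N) ≤ Γ₀(δ)` for `δ ∣ N`. [folklore] -/
theorem mem_Gamma0_of_dvd_level {δ N : ℕ} (hδ : δ ∣ N) {γ : SL(2, ℤ)} (hγ : γ ∈ Gamma0 N) : γ ∈ Gamma0 δ := by
  rw [Gamma0_mem, ZMod.intCast_zmod_eq_zero_iff_dvd] at hγ ⊢
  exact (Int.natCast_dvd_natCast.mpr hδ).trans hγ

/-- **`G_c(γτ) = (cτ+d)² G_c(τ)` for `γ ∈ Γ₀(N)`** when `Σ_δ c_δ = 0`: the anomalies of the `δE₂(δ·)` cancel. [cite: Zagier2008, §2.3] -/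
theorem e2Comb_smul (N : ℕ) (c : ℕ → ℂ) (hc : ∑ δ ∈ N.divisors, c δ = 0) {γ : SL(2, ℤ)} (hγ : γ ∈ Gamma0 N) (τ : ℍ) :
    (∑ δ ∈ N.divisors, c δ * (δ : ℂ) * E2 (sixMulPt δ (γ • τ)))
      = ((γ 1 0 : ℂ) * τ + γ 1 1) ^ 2 * ∑ δ ∈ N.divisors, c δ * (δ : ℂ) * E2 (sixMulPt δ τ) := by
  have hterm : ∀ δ ∈ N.divisors, c δ * (δ : ℂ) * E2 (sixMulPt δ (γ • τ))
      = ((γ 1 0 : ℂ) * τ + γ 1 1) ^ 2 * (c δ * (δ : ℂ) * E2 (sixMulPt δ τ))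
        - 6 * I * (γ 1 0 : ℂ) / π * ((γ 1 0 : ℂ) * τ + γ 1 1) * c δ := by
    intro δ hδ
    have hδ0 : 0 < δ := Nat.pos_of_mem_divisors hδ
    have hδC : (δ : ℂ) ≠ 0 := by exact_mod_cast hδ0.ne'
    have hπ : (π : ℂ) ≠ 0 := ofReal_ne_zero.2 Real.pi_ne_zero
    have h := E2natMul_smul δ hδ0 (mem_Gamma0_of_dvd_level (Nat.dvd_of_mem_divisors hδ) hγ) τ
    simp only [E2natMul] at h
    rw [sixMulPt_of_pos hδ0, sixMulPt_of_pos hδ0, h]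
    field_simp
  rw [Finset.sum_congr rfl hterm, Finset.sum_sub_distrib, ← Finset.mul_sum, ← Finset.mul_sum, hc, mul_zero, sub_zero]

/-- A finite sum of functions bounded at `i∞` is bounded at `i∞`. [folklore] -/
theorem isBoundedAtImInfty_finset_sum {ι : Type*} (s : Finset ι) (f : ι → ℍ → ℂ)
    (h : ∀ i ∈ s, IsBoundedAtImInfty (f i)) : IsBoundedAtImInfty (fun τ : ℍ ↦ ∑ i ∈ s, f i τ) := by
  classical
  induction s using Finset.induction_on with
  | empty =>
    simp only [Finset.sum_empty]
    exact const_boundedAtFilter atImInfty (0 : ℂ)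
  | insert a s ha ih =>
    have hfun : (fun τ : ℍ ↦ ∑ i ∈ insert a s, f i τ) = fun τ : ℍ ↦ f a τ + ∑ i ∈ s, f i τ := by
      funext τ
      rw [Finset.sum_insert ha]
    rw [hfun]
    exact (h a (Finset.mem_insert_self a s)).add (ih fun i hi ↦ h i (Finset.mem_insert_of_mem hi))

/-- A finite sum of holomorphic functions on `ℍ` is holomorphic. [folklore] -/
theorem mdifferentiable_finset_sum {ι : Type*} (s : Finset ι) (f : ι → ℍ → ℂ)
    (h : ∀ i ∈ s, MDifferentiable 𝓘(ℂ) 𝓘(ℂ) (f i)) : MDifferentiable 𝓘(ℂ) 𝓘(ℂ) (fun τ : ℍ ↦ ∑ i ∈ s, f i τ) := by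
  classical
  induction s using Finset.induction_on with
  | empty =>
    simp only [Finset.sum_empty]
    exact mdifferentiable_const
  | insert a s ha ih =>
    have hfun : (fun τ : ℍ ↦ ∑ i ∈ insert a s, f i τ) = fun τ : ℍ ↦ f a τ + ∑ i ∈ s, f i τ := by
      funext τ
      rw [Finset.sum_insert ha]
    rw [hfun]
    exact (h a (Finset.mem_insert_self a s)).add (ih fun i hi ↦ h i (Finset.mem_insert_of_mem hi))

/-- `τ ↦ E₂(δτ)` (through `sixMulPt`) is holomorphic for `δ ≥ 1`. [folklore] -/
theorem mdifferentiable_E2_sixMulPt {δ : ℕ} (hδ : 0 < δ) : MDifferentiable 𝓘(ℂ) 𝓘(ℂ) (fun τ : ℍ ↦ E2 (sixMulPt δ τ)) := by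
  have hfun : (fun τ : ℍ ↦ E2 (sixMulPt δ τ)) = E2natMul δ hδ := by
    funext τ
    rw [sixMulPt_of_pos hδ]
    rfl
  rw [hfun]
  exact mdifferentiable_E2natMul δ hδ

/-- `(τ ↦ E₂(δτ)) ∣₂ A` is bounded at `i∞` for every `A ∈ SL₂(ℤ)` (`δ ≥ 1`). [folklore] -/
theorem isBoundedAtImInfty_E2_sixMulPt_slash {δ : ℕ} (hδ : 0 < δ) (A : SL(2, ℤ)) :
    IsBoundedAtImInfty ((fun τ : ℍ ↦ E2 (sixMulPt δ τ)) ∣[(2 : ℤ)] A) := by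
  have hfun : (fun τ : ℍ ↦ E2 (sixMulPt δ τ)) = E2natMul δ hδ := by
    funext τ
    rw [sixMulPt_of_pos hδ]
    rfl
  rw [hfun]
  exact isBoundedAtImInfty_E2natMul_slash δ hδ A

/-- **`G_c = Σ_{δ∣N} c_δ·δ·E₂(δτ) ∈ M₂(Γ₀(N))` when `Σ_δ c_δ = 0`.** [cite: DiamondShurman2005, §1.2] [cite: Zagier2008, §2.3] -/
theorem exists_modularForm_e2Comb (N : ℕ) [NeZero N] (c : ℕ → ℂ) (hc : ∑ δ ∈ N.divisors, c δ = 0) :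
    ∃ G : ModularForm (Gamma0 N) 2, ∀ τ : ℍ, G τ = ∑ δ ∈ N.divisors, c δ * (δ : ℂ) * E2 (sixMulPt δ τ) := by
  have hslash : ∀ γ : SL(2, ℤ), γ ∈ Gamma0 N →
      ((fun τ : ℍ ↦ ∑ δ ∈ N.divisors, c δ * (δ : ℂ) * E2 (sixMulPt δ τ)) ∣[(2 : ℤ)] γ)
        = fun τ : ℍ ↦ ∑ δ ∈ N.divisors, c δ * (δ : ℂ) * E2 (sixMulPt δ τ) := by
    intro γ hγ
    funext τ
    rw [SL_slash_apply, ModularGroup.denom_apply, e2Comb_smul N c hc hγ τ]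
    have hj : (γ 1 0 : ℂ) * τ + γ 1 1 ≠ 0 := SL2_denom_ne_zero γ τ
    rw [zpow_neg, zpow_ofNat]
    field_simp
  refine ⟨{ toFun := fun τ : ℍ ↦ ∑ δ ∈ N.divisors, c δ * (δ : ℂ) * E2 (sixMulPt δ τ)
            slash_action_eq' := ?_
            holo' := ?_
            bdd_at_cusps' := ?_ }, fun τ ↦ rfl⟩
  · intro A hA
    obtain ⟨γ, hγ, rfl⟩ := hA
    exact hslash γ hγ
  · exact mdifferentiable_finset_sum N.divisors (fun δ τ ↦ c δ * (δ : ℂ) * E2 (sixMulPt δ τ))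
      fun δ hδ ↦ (mdifferentiable_E2_sixMulPt (Nat.pos_of_mem_divisors hδ)).const_smul (c δ * (δ : ℂ))
  · intro cc hcc
    rw [Subgroup.IsArithmetic.isCusp_iff_isCusp_SL2Z] at hcc
    rw [OnePoint.isBoundedAt_iff_forall_SL2Z hcc]
    intro A _
    show IsBoundedAtImInfty ((fun τ : ℍ ↦ ∑ δ ∈ N.divisors, c δ * (δ : ℂ) * E2 (sixMulPt δ τ)) ∣[(2 : ℤ)] (A : GL (Fin 2) ℝ))
    have hfun : ((fun τ : ℍ ↦ ∑ δ ∈ N.divisors, c δ * (δ : ℂ) * E2 (sixMulPt δ τ)) ∣[(2 : ℤ)] (A : GL (Fin 2) ℝ))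
        = fun τ : ℍ ↦ ∑ δ ∈ N.divisors, c δ * (δ : ℂ) * ((fun σ : ℍ ↦ E2 (sixMulPt δ σ)) ∣[(2 : ℤ)] A) τ := by
      rw [← ModularForm.SL_slash]
      funext τ
      simp only [SL_slash_apply, Finset.sum_mul]
      refine Finset.sum_congr rfl fun δ _ ↦ ?_
      ring
    rw [hfun]
    exact isBoundedAtImInfty_finset_sum N.divisors _ fun δ hδ ↦
      (isBoundedAtImInfty_E2_sixMulPt_slash (Nat.pos_of_mem_divisors hδ) A).const_mul_left (c δ * (δ : ℂ))

/-! ## §2 `𝓔′ = (πi/12)·(Σ_δ r_δ δ E₂(δτ))·𝓔` for an `η`-quotient `𝓔`, on `ℍ` -/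

/-- `etaQuotient N r ∘ ofComplex` agrees with `etaQuotientC N r` near every point of `ℍ`. [folklore] -/
theorem etaQuotient_comp_ofComplex_eventuallyEq (N : ℕ) (r : ℕ → ℤ) (τ : ℍ) :
    (etaQuotient N r ∘ ofComplex) =ᶠ[𝓝 (τ : ℂ)] etaQuotientC N r := by
  filter_upwards [isOpen_upperHalfPlaneSet.mem_nhds τ.im_pos] with z hz
  simp only [Function.comp_apply, etaQuotient, ofComplex_apply_of_im_pos hz, UpperHalfPlane.coe_mk]

/-- **`𝓔′ = (πi/12)·G_r·𝓔`** for `𝓔 = ∏_{δ∣N} η(δτ)^{r_δ}` and `G_r = Σ_δ r_δ δ E₂(δτ)`, as functions on `ℍ` (derivative through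
`ofComplex`, the tree's convention). [cite: Zagier2008, §2.3] -/
theorem deriv_etaQuotient_eq_e2Comb (N : ℕ) (r : ℕ → ℤ) (τ : ℍ) :
    deriv (etaQuotient N r ∘ ofComplex) τ
      = (π * I / 12) * (∑ δ ∈ N.divisors, (r δ : ℂ) * (δ : ℂ) * E2 (sixMulPt δ τ)) * etaQuotient N r τ := by
  rw [(etaQuotient_comp_ofComplex_eventuallyEq N r τ).deriv_eq, deriv_etaQuotientC N r τ, etaQuotient]
  congr 2
  rw [← Finset.sum_attach N.divisors (fun δ ↦ (r δ : ℂ) * (δ : ℂ) * E2 (sixMulPt δ τ))]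
  refine Finset.sum_congr rfl fun δ _ ↦ ?_
  rw [sixMulPt_of_pos (Nat.pos_of_mem_divisors δ.2)]

/-- **`x′ = 2πi · (G_r/24) · (x − a)`** reading: with `D = (2πi)⁻¹ d/dτ`, `D𝓔 = (G_r/24)·𝓔`. [cite: Zagier2008, §2.3] -/
theorem deriv_etaQuotient_eq_e2Comb' (N : ℕ) (r : ℕ → ℤ) (τ : ℍ) :
    (2 * π * I)⁻¹ * deriv (etaQuotient N r ∘ ofComplex) τ
      = (1 / 24 : ℂ) * (∑ δ ∈ N.divisors, (r δ : ℂ) * (δ : ℂ) * E2 (sixMulPt δ τ)) * etaQuotient N r τ := by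
  have h2pi : (2 * π * I : ℂ) ≠ 0 := by simp [Real.pi_ne_zero, I_ne_zero]
  rw [deriv_etaQuotient_eq_e2Comb]
  field_simp
  ring

/-! ## §3 The `q`-remainder of `E₂(δτ)` -/

/-- `E₂` is `1`-periodic through `ofComplex` (`E₂|₂T = E₂`, `D₂(T) = 0`). [folklore] -/
theorem periodic_E2_comp_ofComplex : Function.Periodic (E2 ∘ ofComplex) 1 := by
  intro w
  by_cases hw : 0 < w.im
  · have hw1 : 0 < (w + 1).im := by simpa using hw
    simp only [Function.comp_apply, ofComplex_apply_of_im_pos hw, ofComplex_apply_of_im_pos hw1]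
    have h := congrFun (E2_slash_action ModularGroup.T) ⟨w, hw⟩
    rw [SL_slash_apply, D2_T, ModularGroup.denom_apply] at h
    simp only [Pi.sub_apply, Pi.zero_apply, smul_zero, sub_zero] at h
    have hT : ModularGroup.T • (⟨w, hw⟩ : ℍ) = ⟨w + 1, hw1⟩ := by
      apply UpperHalfPlane.ext
      rw [UpperHalfPlane.modular_T_smul]
      simp [UpperHalfPlane.coe_vadd]
      ring
    rw [hT] at h
    have hden : ((ModularGroup.T 1 0 : ℤ) : ℂ) * ((⟨w, hw⟩ : ℍ) : ℂ) + (ModularGroup.T 1 1 : ℤ) = 1 := by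
      simp [ModularGroup.T]
    rw [hden] at h
    simpa using h
  · push Not at hw
    have hw1 : (w + 1).im ≤ 0 := by simpa using hw
    simp only [Function.comp_apply, ofComplex_apply_eq_of_im_nonpos hw1 hw]

/-- `τ ↦ E₂(δτ)` is `1`-periodic through `ofComplex` (`δ ≥ 1`). [folklore] -/
theorem periodic_E2_sixMulPt {δ : ℕ} (hδ : 0 < δ) : Function.Periodic ((fun τ : ℍ ↦ E2 (sixMulPt δ τ)) ∘ ofComplex) 1 := by
  have hper : Function.Periodic (E2 ∘ ofComplex) ((δ : ℕ) * (1 : ℂ)) := periodic_E2_comp_ofComplex.nat_mul δ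
  intro z
  by_cases hz : 0 < z.im
  · have hz1 : 0 < (z + 1).im := by simpa using hz
    have hδz : 0 < ((δ : ℂ) * z).im := by simpa using mul_pos (Nat.cast_pos.mpr hδ) hz
    have hδz1 : 0 < ((δ : ℂ) * (z + 1)).im := by simpa using mul_pos (Nat.cast_pos.mpr hδ) hz1
    have hpt : ∀ {w : ℂ} (hw : 0 < w.im) (hδw : 0 < ((δ : ℂ) * w).im),
        sixMulPt δ (ofComplex w) = ofComplex ((δ : ℂ) * w) := by
      intro w hw hδw
      apply UpperHalfPlane.ext
      rw [sixMulPt_of_pos hδ, coe_natMulPt, ofComplex_apply_of_im_pos hw, ofComplex_apply_of_im_pos hδw]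
    simp only [Function.comp_apply]
    rw [hpt hz1 hδz1, hpt hz hδz]
    have e := hper ((δ : ℂ) * z)
    simp only [Function.comp_apply] at e
    rw [show (δ : ℂ) * (z + 1) = (δ : ℂ) * z + (δ : ℕ) * (1 : ℂ) by ring]
    exact e
  · push Not at hz
    have hz1 : (z + 1).im ≤ 0 := by simpa using hz
    simp only [Function.comp_apply, ofComplex_apply_eq_of_im_nonpos hz1 hz]

/-- `τ ↦ E₂(δτ)` is bounded at `i∞` (`δ ≥ 1`). [folklore] -/
theorem isBoundedAtImInfty_E2_sixMulPt {δ : ℕ} (hδ : 0 < δ) : IsBoundedAtImInfty (fun τ : ℍ ↦ E2 (sixMulPt δ τ)) := by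
  have h := isBoundedAtImInfty_E2_sixMulPt_slash hδ 1
  rwa [SlashAction.slash_one] at h

/-- **`E₂(δτ) = Σ_{n ≤ m} e2NatMulCoeff δ n · qⁿ + o(q^m)`** (`q = e^{2πiτ}`, any `m`). [cite: Zagier2008, §2.3] -/
theorem tendsto_E2_sixMulPt {δ : ℕ} (hδ : 0 < δ) (m : ℕ) :
    Tendsto (fun τ : ℍ ↦ (E2 (sixMulPt δ τ)
      - (∑ n ∈ Finset.range (m + 1), C (e2NatMulCoeff δ n) * X ^ n).eval (Function.Periodic.qParam 1 (τ : ℂ)))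
      / Function.Periodic.qParam 1 (τ : ℂ) ^ m) atImInfty (𝓝 0) := by
  refine tendsto_of_hasSum (periodic_E2_sixMulPt hδ) (mdifferentiable_E2_sixMulPt hδ) (isBoundedAtImInfty_E2_sixMulPt hδ)
    (fun τ ↦ ?_) m
  have h := hasSum_E2_natMul δ hδ τ
  rwa [← sixMulPt_of_pos hδ] at h

/-- The coefficients `e2NatMulCoeff δ n` made explicit: `1` at `n = 0`, `−24σ₁(n/δ)` if `δ ∣ n ≠ 0`, else `0`. [folklore] -/
theorem e2NatMulCoeff_eq (δ n : ℕ) (hδ : 0 < δ) :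
    e2NatMulCoeff δ n = if n = 0 then 1 else if δ ∣ n then -24 * (ArithmeticFunction.sigma 1 (n / δ) : ℂ) else 0 := by
  unfold e2NatMulCoeff e2Coeff
  by_cases hn : n = 0
  · subst hn
    simp
  · by_cases hd : δ ∣ n
    · have hnd : n / δ ≠ 0 := by
        obtain ⟨k, rfl⟩ := hd
        rw [Nat.mul_div_cancel_left k hδ]
        rintro rfl
        exact hn (by simp)
      simp [hd, hn, hnd]
    · simp [hd, hn]

end Summit.BirchSwinnertonDyer.BirchSwinnertonDyer.Theorems.ManinLocalTwoThree.EtaLogDerivativeForms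

end
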